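import Summits.Ventures.AbcSig.Rows.XTemplateBC7
import Summits.Ventures.AbcSig.Levels.N578

/-!
# Venture AbcSig — ROW `XnA7Yn17Z2`: `xⁿ + 2^α yⁿ = 17 z²` for the whole class `7 ≤ α < n` (FAMILY C1b; GENERATED by p-lean gen3/leanrow_c1b7.py)

HONEST FRAMING. A row of a COMPUTATION cell (`pub-abcsig`); a CONDITIONAL theorem, no claim on ABC or any summit.
Hypotheses: `BS04Package` (CITED: [BS04] Lemma 3.3 + (3.1) + Lemma 4.2), `DataComplete` at the
level 578 = 2·17² (COMPUTED, certified level file; case (v₇) for every `α ≥ 7`, both parities of `y`), the `Refines…`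
hypotheses of the kernel module certificates (COMPUTED) if any, and the listed per-orbit exclusions `hX_…` (CITED; the row
of record's R3/R5 name the module / printed argument per orbit: M4 Kraus certificates, M6c, [BS04, Prop. 4.4 / 4.6]).
Everything else is kernel-checked (`Rows/XTemplateBC7.lean`, `Levels/N578….lean`). The exponent `α` is the REDUCED
2-exponent of RULING H1 (`7 ≤ α ≤ n − 1`, p1's `Rows.AlphaGe7Reduced`); the statement is uniform in `α`.
Exponent range: prime `n ≥ 11`, n ∉ [17]; `x·y ≠ ±1`.
Row of record: `census/rows/C1b/C1b-C17-a7plus.md` (sha16 `42738db36eb44f14`; R8-signed by referee ref-g20, 2026-08-22T23:18Z); p1's statement of record: the conjunct `Rows.C1bCell 17 Rows.AlphaGe7Reduced 11 ∅` of `Rows.C1bSmallAlphaSigned` (`Rows/StatementsC1b.lean`). Residual exponents of OUR kernel sieve at level 578 that the row closes by a module (M4 Kraus certificates — family-specific, not reusable from the C1 tables —, M6 / M6c, [BS04, Prop. 4.4 / 4.6]) enter as the named hypotheses `hX_… : n ∈ [...] → M.Excludes …` (CITED), as do rational orbits not eliminable by the sieve (all n).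
-/

namespace Summit.Ventures.AbcSig

/-- Row `XnA7Yn17Z2`: no primitive solution of `xⁿ + 2^α yⁿ = 17 z²` with `x·y ≠ ±1` for prime `n ≥ 11`, `n ∉ [17]`
and every `α` with `7 ≤ α < n`, conditional on the named hypotheses. -/
theorem xrow_XnA7Yn17Z2 (M : NewformModel) (hP : M.BS04Package)
    (hD578 : M.DataComplete 578 level578Orbits)
    (n : ℕ) (hn : n.Prime) (hmin : 11 ≤ n) (hres : n ∉ ([17] : List ℕ)) (α : ℕ) (hα7 : 7 ≤ α) (hαn : α < n)
    (hX_orbit_578_1 : M.Excludes 578 orbit_578_1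
      (famBCge7 17 n))
    (x y z : ℤ) (hxy1 : x * y ≠ 1) (hxy2 : x * y ≠ -1) : ¬ IsPrimitiveSolution 1 (2 ^ α) 17 n x y z := by
  have h7 : 7 ≤ n := by omega
  have hC : Nat.Prime 17 := by norm_num
  have hsq : Squarefree (17 : ℕ) := (Nat.prime_iff.mp hC).squarefree
  have hnC : ¬ n ∣ 17 := by
    intro h
    simp only [List.mem_cons, List.not_mem_nil, or_false] at hres; rcases (Nat.dvd_prime hC).mp h with h1 | h1 <;> omega
  exact xbranchBC_ge7 α 17 hsq (by decide) M hP hD578 n hn h7 hnC hα7 hαn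
    (level578_sieve n hn h7 (fun o => M.Excludes 578 o
      (famBCge7 17 n) ∨ M.ExcludesStd 578 o n) (Or.inl hX_orbit_578_1) (fun hmem => by
      obtain rfl : n = 7 := by simpa using hmem
      omega) (fun hmem => by
      obtain rfl : n = 7 := by simpa using hmem
      omega) (fun hmem => by
      obtain rfl : n = 17 := by simpa using hmem
      exact absurd (by simp) hres) (fun hmem => by
      obtain rfl : n = 17 := by simpa using hmem
      exact absurd (by simp) hres))
    x y z hxy1 hxy2

end Summit.Ventures.AbcSig
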